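import Summits.NavierStokesRegularity.FluidComputer.PalasekTowerDepthAssembly
import Summits.NavierStokesRegularity.FluidComputer.PalasekTowerRegister
import Summits.NavierStokesRegularity.FluidComputer.PalasekTowerSilentTail

/-!
# The depth ladder over the planner's REGISTER v2.1: rungs of record, the limit-closed core ledger,
# and the silent tail of the items of record

Cell `ns-blowup`, seat `ns-blowup-ecbridge-1` (g2); companion of `PalasekTowerDepthAssembly.lean`
(this seat) and `PalasekTowerRegister.lean` (p407242, seat `ns-blowup-lean`: `Schedule.Rigid`
(window equality, `c₅ = 4bβ`, `c₁ = 1`, `c₂ = 5/3`), `CoreLedger`, `Margins.register`, the items of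
record `EpisodeBaseR` / `EpisodeInductionR` at `ν = 1`, `TowerRates.wide`, `Λ = 8`, `θ = 6/5`).
LABEL: E-C typing; WHAT THIS IS NOT: not Navier–Stokes evidence — one-line consequences of landed
declarations and one relaxed definition; no stage, tower or instance is constructed or claimed.

* §1 The register margin is level-monotone and force-blind (`Margins.levelMonotone_register`,
  `Margins.forceBlind_register`); hence (planner ADDENDUM l.1015 (1), now BY NAME)
  `realisation_silent_of_episodesR : EpisodeBaseR → EpisodeInductionR → ∃ W b, b < W.T ∧ W.f ≡ 0 on
  [b, ∞)` — the items of record assert an autonomous cascade from some time strictly before blow-up;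
  and, in the tree's continuation vocabulary (`PalasekTowerSilentTail`, p408508),
  `unforced_blowup_of_episodesR`: an UNFORCED classical solution on `[b, T)` from a `C^∞`
  finite-energy divergence-free state with no classical unforced continuation past `T`.
* §2 RUNGS OF RECORD `RungR K := PinnedDepth 1 wide 8 (6/5) (Margins.register wide) K`:
  `rungR_one_iff : RungR 1 ↔ EpisodeBaseR`, `RungR.mono`, `RungR.episodeBaseR`, `rungR_of_episodesR`
  (K1R ∧ K2R ⇒ every rung), `DepthTower.rungR` (a SHAPE-E rung at `Registry.record` over the register
  margin is a rung of record). `RungR 2` = the BC5 plan-only rung (first hand-over).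
* §3 THE LIMIT-CLOSED CORE LEDGER `CoreLedgerLip` (the loop class relaxed from `C¹` with speed
  `≤ 8π/N_j` to `8π/N_j`-Lipschitz on `[0,1]`): uniform limits of such loops stay in the class and
  circulation passes to the limit (weak-* convergence of the derivatives), whereas a `C¹` loop with
  circulation `≥ c` need not survive re-smoothing of a Lipschitz limit when the inequality is tight —
  so SHAPE-E's compactness item is stated over `Margins.registerLip := Rigid ∧ CoreLedgerLip`;
  `CoreLedger.lip` (mean value inequality), `Margins.register_lip`, monotonicity / force-blindness,
  and the direction that matters for the pivot: K1R of record ⇒ SHAPE-E's first rung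
  (`EpisodeBaseR.depthRung_lip`-type statements are for the filer; here `EpisodeBasePinned` over the
  register implies it over `registerLip`, `EpisodeBasePinned.lip`).

References: S. Palasek, arXiv:2605.13827 §3–§4 [cite: Palasek2026ElementaryModel, §3–§4];
C. L. Fefferman, Clay problem description, (C) [cite: FeffermanClay2006, (C)].
-/

noncomputable section

namespace Summit.NavierStokesRegularity.FluidComputer.PalasekTowerClayBridge

open Set MeasureTheory Filter Topology Function
open scoped ENNReal ContDiff NNReal
open Literature.Analysis.FluidPDE

/-! ## §1 The register margin: level-monotone, force-blind; the silent tail of the items of record -/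

/-- The register margin is level-monotone (`Margins.register_mono`). [folklore] -/
theorem Margins.levelMonotone_register (R : TowerRates) : (Margins.register R).LevelMonotone :=
  fun _ _ _ _ hk h => Margins.register_mono hk h

/-- The register margin is FORCE-BLIND: rigidity reads times and constants, the core ledger reads the
velocity at readouts, the ball and `c₁` — all kept by re-forcing. [folklore] -/
theorem Margins.forceBlind_register (R : TowerRates) : (Margins.register R).ForceBlind :=
  fun _ _ _ _ _ _ _ _ h => ⟨⟨h.1.window_eq, h.1.c₅_eq, h.1.c₁_eq, h.1.c₂_eq⟩, h.2⟩

/-- **The items of record assert the silent tail** (planner ADDENDUM l.1015 (1) «K2R of record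
asserts AUTONOMOUS heredity», by name): `EpisodeBaseR ∧ EpisodeInductionR` yield a realisation of the
tower on the wide-base rates at unit viscosity whose force vanishes identically from some time
strictly before its blow-up time. [cite: Palasek2026ElementaryModel, §4 and Rem. 1.4] -/
theorem realisation_silent_of_episodesR (h₁ : EpisodeBaseR) (h₂ : EpisodeInductionR) :
    ∃ W : Realisation 1 TowerRates.wide, ∃ b, b < W.T ∧ ∀ t, b ≤ t → ∀ x, W.f t x = 0 :=
  realisation_silent_of_episodesPinned h₁ h₂ (Margins.forceBlind_register TowerRates.wide)

/-- **The items of record assert an UNFORCED finite-time loss of smoothness** (planner ADDENDUM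
l.1015 (1), second half, by name): from `EpisodeBaseR ∧ EpisodeInductionR`, a realisation `W` on the
wide-base rates at unit viscosity and a time `b ∈ [0, T)` such that `(W.u, W.p)` solves the UNFORCED
system classically on `[b, T)`, the state `W.u b` is `C^∞`, divergence free and of finite energy (no
rapid decay claimed — not a Clay datum), and no classical unforced solution on any `[b, T')`,
`T' > T`, continues it (`Realisation.unforced_blowup_after`, p408508). [cite: Palasek2026ElementaryModel, §4 and Rem. 1.4] -/
theorem unforced_blowup_of_episodesR (h₁ : EpisodeBaseR) (h₂ : EpisodeInductionR) :
    ∃ W : Realisation 1 TowerRates.wide, ∃ b, 0 ≤ b ∧ b < W.T ∧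
      IsClassicalNSSolutionOn (Ico b W.T) 1 0 W.u W.p ∧
      ContDiff ℝ ∞ (W.u b) ∧ NSWave0.IsDivFree (W.u b) ∧
      (∃ C : ℝ≥0∞, C < ⊤ ∧ ∫⁻ x, ‖W.u b x‖ₑ ^ 2 ≤ C) ∧
      ∀ T', W.T < T' →
        ¬ ∃ (u' : ℝ → EuclideanSpace ℝ (Fin 3) → EuclideanSpace ℝ (Fin 3))
            (p' : ℝ → EuclideanSpace ℝ (Fin 3) → ℝ),
            IsClassicalNSSolutionOn (Ico b T') 1 0 u' p' ∧ ∀ t ∈ Ico b W.T, u' t = W.u t := by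
  obtain ⟨S, hS, ⟨s₁⟩⟩ := h₁
  -- silence from `b := τ 1 + 1`-type times is not needed: take `b` half-way between `τ 1` and `T`
  have hb : S.τ 1 < (S.τ 1 + S.T) / 2 := by linarith [S.τ_lt_T 1]
  have hbT : (S.τ 1 + S.T) / 2 < S.T := by linarith [S.τ_lt_T 1]
  have hb0 : 0 ≤ (S.τ 1 + S.T) / 2 := by linarith [S.τ_pos 1]
  obtain ⟨W, hW, hT⟩ := EpisodeInductionPinned.realisation_silent h₂
    (Margins.forceBlind_register TowerRates.wide) hS s₁ hb
  have hbT' : (S.τ 1 + S.T) / 2 < W.T := by rw [hT]; exact hbT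
  exact ⟨W, (S.τ 1 + S.T) / 2, hb0, hbT', W.unforced_blowup_after hb0 hbT' hW⟩

/-! ## §2 Rungs of record -/

/-- **Rung `K` of record**: some schedule pinned at `(Λ, θ) = (8, 6/5)` on the wide-base rates admits a
strained stage at level `K` with the register margin, at unit viscosity (open for every `K ≥ 1`;
never asserted). `RungR 1` is `EpisodeBaseR`; `RungR 2` is the route's BC5 plan-only rung (the first
hand-over, one level below K2R's range). [cite: Palasek2026ElementaryModel, §4] -/
@[conjecture] def RungR (K : ℕ) : Prop :=
  PinnedDepth 1 TowerRates.wide 8 (6 / 5) (Margins.register TowerRates.wide) K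

/-- The first rung of record is K1R of record, verbatim. [folklore] -/
theorem rungR_one_iff : RungR 1 ↔ EpisodeBaseR := Iff.rfl

/-- The rungs of record form a ladder. [folklore] -/
theorem RungR.mono {K K' : ℕ} (hK : K ≤ K') (h : RungR K') : RungR K :=
  PinnedDepth.mono (Margins.levelMonotone_register TowerRates.wide) hK h

/-- Every rung `K ≥ 1` of record is a K1R-of-record witness. [folklore] -/
theorem RungR.episodeBaseR {K : ℕ} (hK : 1 ≤ K) (h : RungR K) : EpisodeBaseR :=
  rungR_one_iff.1 (h.mono hK)

/-- The items of record give every rung. [folklore] -/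
theorem rungR_of_episodesR (h₁ : EpisodeBaseR) (h₂ : EpisodeInductionR) (K : ℕ) : RungR (K + 1) :=
  pinnedDepth_of_episodesPinned h₁ h₂ K

/-- **A SHAPE-E rung at `Registry.record` over the register margin is a rung of record** (the two
ladders share their statements at every depth). [folklore] -/
theorem DepthTower.rungR {V : ClayEnvelope} {K : ℕ}
    (h : DepthTower 1 TowerRates.wide Registry.record V
      (Margins.withStrain (Margins.register TowerRates.wide)) K) : RungR K :=
  h.pinnedDepth

/-! ## §3 The limit-closed core ledger and SHAPE-E's margin over the register -/

/-- **The core ledger with LIPSCHITZ loops** (limit-closed form of `CoreLedger`): at each readout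
`τ j`, `j ≤ k`, some closed loop that is `8π/N_j`-Lipschitz on `[0, 1]` (hence of length `≤ 8π/N_j`;
its a.e. derivative enters `circulation`) inside a ball of radius `1/N_j` centred in the tower's ball
carries circulation `≥ c₁ N_j^{β-2}`. Uniform limits of such loops stay in the class and the
circulation inequality passes to the limit (weak-* convergence of the derivatives against the uniformly
convergent smooth velocities) — the property compactness needs; the `C¹` class of `CoreLedger` is not
closed under such limits. [cite: Palasek2026ElementaryModel, §3.1] -/
def CoreLedgerLip (R : TowerRates) (S : Schedule R) (k : ℕ)
    (u : ℝ → EuclideanSpace ℝ (Fin 3) → EuclideanSpace ℝ (Fin 3)) : Prop :=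
  ∀ j, j ≤ k → ∃ (x : EuclideanSpace ℝ (Fin 3)) (γ : ℝ → EuclideanSpace ℝ (Fin 3)),
    ‖x‖ ≤ S.radius ∧ γ 0 = γ 1 ∧
    (∀ s ∈ Icc (0 : ℝ) 1, γ s ∈ Metric.closedBall x (1 / R.N j)) ∧
    (∀ s ∈ Icc (0 : ℝ) 1, ∀ t ∈ Icc (0 : ℝ) 1, ‖γ s - γ t‖ ≤ 8 * Real.pi / R.N j * |s - t|) ∧
    S.c₁ * R.N j ^ (R.β - 2) ≤ circulation (u (S.τ j)) γ

/-- **`C¹` cores are Lipschitz cores** (mean value inequality on `[0, 1]`). [folklore] -/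
theorem CoreLedger.lip {R : TowerRates} {S : Schedule R} {k : ℕ}
    {u : ℝ → EuclideanSpace ℝ (Fin 3) → EuclideanSpace ℝ (Fin 3)} (h : CoreLedger R S k u) :
    CoreLedgerLip R S k u := by
  intro j hj
  obtain ⟨x, γ, hx, hγ, hcl, hball, hspeed, hcirc⟩ := h j hj
  refine ⟨x, γ, hx, hcl, hball, ?_, hcirc⟩
  intro s hs t ht
  have hdiff : ∀ r ∈ Icc (0 : ℝ) 1, DifferentiableAt ℝ γ r :=
    fun r _ => (hγ.differentiable one_ne_zero).differentiableAt
  have key := (convex_Icc (0 : ℝ) 1).norm_image_sub_le_of_norm_deriv_le hdiff hspeed ht hs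
  calc ‖γ s - γ t‖ ≤ 8 * Real.pi / R.N j * ‖s - t‖ := key
    _ = 8 * Real.pi / R.N j * |s - t| := by rw [Real.norm_eq_abs]

/-- The Lipschitz core ledger is monotone in the level. [folklore] -/
theorem CoreLedgerLip.mono {R : TowerRates} {S : Schedule R} {k k' : ℕ} (hk : k ≤ k')
    {u : ℝ → EuclideanSpace ℝ (Fin 3) → EuclideanSpace ℝ (Fin 3)} (h : CoreLedgerLip R S k' u) :
    CoreLedgerLip R S k u :=
  fun j hj => h j (hj.trans hk)

/-- **SHAPE-E's margin over the register**: rigidity and the LIPSCHITZ core ledger (the strain floor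
is added by `Margins.withStrain` as in the items of record). [cite: Palasek2026ElementaryModel, §3–§4] -/
def Margins.registerLip (R : TowerRates) : Margins R := fun S k u => S.Rigid ∧ CoreLedgerLip R S k u

/-- The register margin implies its Lipschitz form. [folklore] -/
theorem Margins.register_lip {R : TowerRates} {S : Schedule R} {k : ℕ}
    {u : ℝ → EuclideanSpace ℝ (Fin 3) → EuclideanSpace ℝ (Fin 3)} (h : Margins.register R S k u) :
    Margins.registerLip R S k u :=
  ⟨h.1, h.2.lip⟩

/-- The Lipschitz register margin is level-monotone. [folklore] -/
theorem Margins.levelMonotone_registerLip (R : TowerRates) :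
    (Margins.registerLip R).LevelMonotone :=
  fun _ _ _ _ hk h => ⟨h.1, h.2.mono hk⟩

/-- The Lipschitz register margin is force-blind. [folklore] -/
theorem Margins.forceBlind_registerLip (R : TowerRates) : (Margins.registerLip R).ForceBlind :=
  fun _ _ _ _ _ _ _ _ h => ⟨⟨h.1.window_eq, h.1.c₅_eq, h.1.c₁_eq, h.1.c₂_eq⟩, h.2⟩

/-- A strained stage for the register margin is a strained stage for its Lipschitz form. [folklore] -/
def Stage.lip {ν : ℝ} {R : TowerRates} {S : Schedule R} {k : ℕ}
    (s : Stage ν R S (Margins.withStrain (Margins.register R)) k) :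
    Stage ν R S (Margins.withStrain (Margins.registerLip R)) k where
  u := s.u
  p := s.p
  classical := s.classical
  initial := s.initial
  energy := s.energy
  floor := s.floor
  ceiling := s.ceiling
  quiet := s.quiet
  margin := ⟨s.margin.1, Margins.register_lip s.margin.2⟩

/-- **The direction that matters for the pivot**: a K1R witness over the register is one over its
Lipschitz form — so K1R of record inhabits SHAPE-E's first rung over `registerLip`. [folklore] -/
theorem EpisodeBasePinned.lip {ν : ℝ} {R : TowerRates} {Λ θ : ℝ}
    (h : EpisodeBasePinned ν R Λ θ (Margins.register R)) :
    EpisodeBasePinned ν R Λ θ (Margins.registerLip R) := by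
  obtain ⟨S, hS, ⟨s⟩⟩ := h
  exact ⟨S, hS, ⟨s.lip⟩⟩

/-- **SHAPE-E's items over the register** (for the sibling route's Sketch; open, never asserted):
uniform finite depth and compactness at unit viscosity on the wide-base rates, registry
`Registry.record`, margin = strain floor on top of rigidity and the Lipschitz core ledger.
[cite: Palasek2026ElementaryModel, §4] -/
@[conjecture] def UniformDepthTowersR : Prop :=
  UniformDepthTowers 1 TowerRates.wide Registry.record
    (Margins.withStrain (Margins.registerLip TowerRates.wide))

/-- SHAPE-E's compactness item over the register (open here; folklore-grade). [folklore] -/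
@[conjecture] def TowerCompactnessR : Prop :=
  TowerCompactness 1 TowerRates.wide Registry.record
    (Margins.withStrain (Margins.registerLip TowerRates.wide))

/-- **SHAPE-E's items of record realise the interface** at unit viscosity on the wide-base rates.
[cite: Palasek2026ElementaryModel, §4] -/
theorem nonempty_realisation_of_depthR (h₁ : UniformDepthTowersR) (h₂ : TowerCompactnessR) :
    Nonempty (Realisation 1 TowerRates.wide) :=
  nonempty_realisation_of_depth h₁ h₂

/-- **SHAPE-E's items of record, BOUNDED form** (recommended filing form: the finite-depth item carries
uniform solution bounds, the compactness item is Arzelà–Ascoli grade; open, never asserted).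
[cite: Palasek2026ElementaryModel, §4] -/
@[conjecture] def UniformDepthTowersBoundedR : Prop :=
  UniformDepthTowersBounded 1 TowerRates.wide Registry.record
    (Margins.withStrain (Margins.registerLip TowerRates.wide))

/-- SHAPE-E's bounded compactness item over the register (open here; Arzelà–Ascoli grade). [folklore] -/
@[conjecture] def TowerCompactnessBoundedR : Prop :=
  TowerCompactnessBounded 1 TowerRates.wide Registry.record
    (Margins.withStrain (Margins.registerLip TowerRates.wide))

/-- The bounded items refine the plain ones: K1R-E (bounded) ⇒ K1R-E, K2R-E ⇒ K2R-E (bounded). [folklore] -/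
theorem uniformDepthTowersR_of_bounded (h : UniformDepthTowersBoundedR) : UniformDepthTowersR :=
  UniformDepthTowersBounded.uniformDepthTowers h

/-- … and K2R-E ⇒ K2R-E (bounded). [folklore] -/
theorem towerCompactnessBoundedR_of_plain (h : TowerCompactnessR) : TowerCompactnessBoundedR :=
  TowerCompactness.bounded h

/-- **SHAPE-E's bounded items of record realise the interface.** [cite: Palasek2026ElementaryModel, §4] -/
theorem nonempty_realisation_of_depthBoundedR (h₁ : UniformDepthTowersBoundedR)
    (h₂ : TowerCompactnessBoundedR) : Nonempty (Realisation 1 TowerRates.wide) :=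
  nonempty_realisation_of_depthBounded h₁ h₂

end Summit.NavierStokesRegularity.FluidComputer.PalasekTowerClayBridge

end
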